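import Summits.NavierStokesRegularity.NavierStokesRegularity.Theorems.PoloidalWindowDoorPoloidalWindowRigidityZShockCompactDisturbance
import Summits.NavierStokesRegularity.NavierStokesRegularity.Theorems.PoloidalWindowDoorPoloidalWindowRigidityZShockQuietTools
import HarnessLib

/-!
# Crux K2 `PoloidalWindowRigidity` (stmt-NavierStokesRegularity-19708), line `z_shock` — R2 without sign hypothesis: John's weighted
# Riccati law along a forward characteristic, and the STRUCTURE OF THE RESIDUAL (loaded characteristics must return to the
# degenerate set or to the opposite sign of `κ'` at one end)

`--supports stmt-NavierStokesRegularity-19708 --as helper` (leafhand-ns-poloidalwindowdoor-3 g3, cell decomp-ns, 2026-08-31).  Class-free,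
Mathlib + tree files only.  **No stub and no summit is closed by this file; Navier–Stokes regularity is NOT proved here (rung 0).**

For a two-sided `C²` solution `(w, p)` of the autonomous p-system `p_z = −κ(w)² w_x`, `w_z = −p_x` on `ℝ × ℝ` (`κ > 0`, `κ ∈ C¹`,
`κ(w) ≤ κhi`, `|κ'(w)| ≤ k₁`, `|w_x| ≤ W₁` along the solution; NO sign hypothesis on `κ'`) and a forward characteristic `X`
(`X' = κ(w(z, X z))`):

* `forwardGradient_hasDerivAt` — Lax: the forward gradient `α(z) = (p_x + κ(w) w_x)(z, X z)` solves the LINEAR law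
  `α' = −(κ'(w) w_x) α`; `forwardGradient_ne_zero` — so it vanishes nowhere on `X` if it is nonzero at one height («loaded»).
* `johnGradient_hasDerivAt` — ★ John's weighted gradient `q = e^{½ log κ(w ∘ X)} α` solves the PURE Riccati law `q' = −G(w ∘ X) q²`
  with `G(u) = κ'(u) e^{−½ log κ(u)} / (2κ(u))` (`= κ'(u)/(2κ(u)^{3/2})`), EXACTLY and with no sign hypothesis (the identity
  `w_z − κ(w) w_x = −α` absorbs the linear term).  Reusable entrance for every two-sided argument on this line.
* `loaded_char_not_eventually_pos` / `loaded_char_not_eventually_neg` — ★ STRUCTURE OF THE RESIDUAL: along a loaded forward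
  characteristic, `κ'(w ∘ X)` can NOT be `≥ ε > 0` near both ends `z → ±∞`, nor `≤ −ε` near both ends.  So any non-constant two-sided
  solution with sign-changing `κ'` must, on every loaded characteristic and at at least one end, keep returning to the region
  `{|κ'| < ε}` or to the opposite sign — for every `ε > 0` («recurrence to the inflection set»): the 1-D shadow of the census's
  «internal inflection value is the only danger».  (`…ZShockQuietInvariant` is the case where quiet data pin `w ∘ X` to one limit.)
[folklore] (Lax 1964; John 1974; Klainerman–Majda 1980)
-/

noncomputable section

namespace Summit.NavierStokesRegularity.NavierStokesRegularity.Theorems.PoloidalWindowDoorPoloidalWindowRigidityZShockLoadedCharacteristics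

-- the summit and its single sub-problem share the name (CONVENTIONS §1)
set_option linter.dupNamespace false

open Set Filter Topology Function Metric
open Summit.NavierStokesRegularity.NavierStokesRegularity.Theorems.PoloidalWindowDoorPoloidalWindowRigidityZShockCharacteristicRiccati
open Summit.NavierStokesRegularity.NavierStokesRegularity.Theorems.PoloidalWindowDoorPoloidalWindowRigidityZShockPSystemLiouville
open Summit.NavierStokesRegularity.NavierStokesRegularity.Theorems.PoloidalWindowDoorPoloidalWindowRigidityZShockCompactDisturbance
open Summit.NavierStokesRegularity.NavierStokesRegularity.Theorems.PoloidalWindowDoorPoloidalWindowRigidityZShockQuietTools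

variable {w p : ℝ × ℝ → ℝ} {κ κ' K : ℝ → ℝ} {κhi k₁ W₁ : ℝ} {X : ℝ → ℝ}

/-- **Lax's linear law for the forward gradient along a forward characteristic**: `α = p_x + κ(w) w_x` evaluated along `X`
solves `α' = −(κ'(w) w_x) α`. [folklore] -/
theorem forwardGradient_hasDerivAt (hw : ContDiff ℝ 2 w) (hp : ContDiff ℝ 2 p)
    (hK2 : ContDiff ℝ 2 K) (hKd : ∀ v, HasDerivAt K (κ v) v) (hκd : ∀ v, HasDerivAt κ (κ' v) v)
    (hsys1 : ∀ q, fderiv ℝ p q (1, 0) = -(κ (w q) ^ 2 * fderiv ℝ w q (0, 1)))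
    (hsys2 : ∀ q, fderiv ℝ w q (1, 0) = -fderiv ℝ p q (0, 1))
    (hX : ∀ z, HasDerivAt X (κ (w (z, X z))) z) (z : ℝ) :
    HasDerivAt (fun t => fderiv ℝ p (t, X t) (0, 1) + κ (w (t, X t)) * fderiv ℝ w (t, X t) (0, 1))
      (-(κ' (w (z, X z)) * fderiv ℝ w (z, X z) (0, 1)) *
        (fderiv ℝ p (z, X z) (0, 1) + κ (w (z, X z)) * fderiv ℝ w (z, X z) (0, 1))) z := by
  have hw1 : Differentiable ℝ w := hw.differentiable (by simp)
  have hp1 : Differentiable ℝ p := hp.differentiable (by simp)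
  -- the forward Riemann invariant `r = p + K(w)`
  set r : ℝ × ℝ → ℝ := fun q => p q + K (w q) with hrdef
  have hr2 : ContDiff ℝ 2 r := hp.add (hK2.comp hw)
  have hKw : ∀ q, HasFDerivAt (fun q' => K (w q')) (κ (w q) • fderiv ℝ w q) q :=
    fun q => (hKd (w q)).comp_hasFDerivAt q (hw1 q).hasFDerivAt
  have hrF : ∀ q, HasFDerivAt r (fderiv ℝ p q + κ (w q) • fderiv ℝ w q) q :=
    fun q => (hp1 q).hasFDerivAt.add (hKw q)
  have hrD : ∀ q v, fderiv ℝ r q v = fderiv ℝ p q v + κ (w q) * fderiv ℝ w q v := by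
    intro q v; rw [(hrF q).fderiv]; simp [smul_eq_mul]
  set c₁ : ℝ × ℝ → ℝ := fun q => κ (w q) with hc₁
  have hκw : ∀ q, HasFDerivAt (fun q' => κ (w q')) (κ' (w q) • fderiv ℝ w q) q :=
    fun q => (hκd (w q)).comp_hasFDerivAt q (hw1 q).hasFDerivAt
  have hc₁d : Differentiable ℝ c₁ := fun q => (hκw q).differentiableAt
  have hc₁x : ∀ q, fderiv ℝ c₁ q (0, 1) = κ' (w q) * fderiv ℝ w q (0, 1) := by
    intro q; rw [hc₁, (hκw q).fderiv]; simp [smul_eq_mul]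
  have hPDE1 : ∀ q, fderiv ℝ r q (1, 0) + c₁ q * fderiv ℝ r q (0, 1) = 0 := by
    intro q; rw [hrD, hrD, hc₁, hsys1, hsys2]; ring
  have h := transversal_deriv_along_of_speed hr2 hc₁d hPDE1 hX z
  rw [hc₁x, hrD] at h
  have hfun : (fun t => fderiv ℝ r (t, X t) (0, 1)) =
      fun t => fderiv ℝ p (t, X t) (0, 1) + κ (w (t, X t)) * fderiv ℝ w (t, X t) (0, 1) := funext fun t => hrD _ _
  rw [hfun] at h
  refine h.congr_deriv ?_
  ring

/-- **A loaded characteristic stays loaded**: if the forward gradient is nonzero at one height of `X`, it is nonzero at every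
height (linear law with bounded coefficient). [folklore] -/
theorem forwardGradient_ne_zero (hw : ContDiff ℝ 2 w) (hp : ContDiff ℝ 2 p)
    (hK2 : ContDiff ℝ 2 K) (hKd : ∀ v, HasDerivAt K (κ v) v) (hκd : ∀ v, HasDerivAt κ (κ' v) v)
    (hsys1 : ∀ q, fderiv ℝ p q (1, 0) = -(κ (w q) ^ 2 * fderiv ℝ w q (0, 1)))
    (hsys2 : ∀ q, fderiv ℝ w q (1, 0) = -fderiv ℝ p q (0, 1))
    (hk₁ : ∀ q, |κ' (w q)| ≤ k₁) (hW₁ : ∀ q, |fderiv ℝ w q (0, 1)| ≤ W₁)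
    (hX : ∀ z, HasDerivAt X (κ (w (z, X z))) z) {z₀ : ℝ}
    (h0 : fderiv ℝ p (z₀, X z₀) (0, 1) + κ (w (z₀, X z₀)) * fderiv ℝ w (z₀, X z₀) (0, 1) ≠ 0) :
    ∀ z, fderiv ℝ p (z, X z) (0, 1) + κ (w (z, X z)) * fderiv ℝ w (z, X z) (0, 1) ≠ 0 := by
  refine ne_zero_of_linear (G := k₁ * W₁) (z₀ := z₀)
    (fun z => forwardGradient_hasDerivAt hw hp hK2 hKd hκd hsys1 hsys2 hX z) (fun z => ?_) h0
  rw [abs_neg, abs_mul]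
  exact mul_le_mul (hk₁ _) (hW₁ _) (abs_nonneg _) ((abs_nonneg _).trans (hk₁ (z, X z)))

/-- **★ John's weighted gradient solves a pure Riccati law, with no sign hypothesis.**  With `α` the forward gradient along `X`
and `q(z) = e^{½ log κ(w(z, X z))} α(z)`:  `q' = −G(w(z, X z)) q²`, `G(u) = κ'(u) e^{−½ log κ(u)} / (2κ(u))`. [folklore] -/
theorem johnGradient_hasDerivAt (hw : ContDiff ℝ 2 w) (hp : ContDiff ℝ 2 p)
    (hK2 : ContDiff ℝ 2 K) (hKd : ∀ v, HasDerivAt K (κ v) v) (hκd : ∀ v, HasDerivAt κ (κ' v) v)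
    (hsys1 : ∀ q, fderiv ℝ p q (1, 0) = -(κ (w q) ^ 2 * fderiv ℝ w q (0, 1)))
    (hsys2 : ∀ q, fderiv ℝ w q (1, 0) = -fderiv ℝ p q (0, 1)) (hκpos : ∀ v, 0 < κ v)
    (hX : ∀ z, HasDerivAt X (κ (w (z, X z))) z) (z : ℝ) :
    HasDerivAt (fun t => Real.exp (Real.log (κ (w (t, X t))) / 2) *
        (fderiv ℝ p (t, X t) (0, 1) + κ (w (t, X t)) * fderiv ℝ w (t, X t) (0, 1)))
      (-(κ' (w (z, X z)) / (2 * κ (w (z, X z))) * Real.exp (-(Real.log (κ (w (z, X z))) / 2)) *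
        (Real.exp (Real.log (κ (w (z, X z))) / 2) *
          (fderiv ℝ p (z, X z) (0, 1) + κ (w (z, X z)) * fderiv ℝ w (z, X z) (0, 1))) ^ 2)) z := by
  have hw1 : Differentiable ℝ w := hw.differentiable (by simp)
  have hκz : κ (w (z, X z)) ≠ 0 := (hκpos _).ne'
  have hφd : HasDerivAt (fun t => w (t, X t))
      (fderiv ℝ w (z, X z) (1, 0) + κ (w (z, X z)) * fderiv ℝ w (z, X z) (0, 1)) z :=
    hasDerivAt_along (hw1 (z, X z)) (hX z)
  have h1 : HasDerivAt (fun t => κ (w (t, X t)))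
      (κ' (w (z, X z)) * (fderiv ℝ w (z, X z) (1, 0) + κ (w (z, X z)) * fderiv ℝ w (z, X z) (0, 1))) z :=
    (hκd (w (z, X z))).comp z hφd
  have h2 := ((h1.log hκz).div_const 2).exp
  have h3 := h2.mul (forwardGradient_hasDerivAt hw hp hK2 hKd hκd hsys1 hsys2 hX z)
  refine h3.congr_deriv ?_
  rw [hsys2 (z, X z), Real.exp_neg]
  field_simp
  ring

/-- **★ Structure of the residual, positive side.**  Along a loaded forward characteristic (`α(z₀) ≠ 0`), `κ'(w ∘ X)` cannot be
`≥ ε > 0` on both a right half-line `[T, ∞)` and a left half-line `(−∞, S]` of heights. [folklore] -/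
theorem loaded_char_not_eventually_pos (hw : ContDiff ℝ 2 w) (hp : ContDiff ℝ 2 p)
    (hK2 : ContDiff ℝ 2 K) (hKd : ∀ v, HasDerivAt K (κ v) v) (hκd : ∀ v, HasDerivAt κ (κ' v) v)
    (hsys1 : ∀ q, fderiv ℝ p q (1, 0) = -(κ (w q) ^ 2 * fderiv ℝ w q (0, 1)))
    (hsys2 : ∀ q, fderiv ℝ w q (1, 0) = -fderiv ℝ p q (0, 1)) (hκpos : ∀ v, 0 < κ v)
    (hκhi : ∀ q, κ (w q) ≤ κhi) (hk₁ : ∀ q, |κ' (w q)| ≤ k₁) (hW₁ : ∀ q, |fderiv ℝ w q (0, 1)| ≤ W₁)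
    (hX : ∀ z, HasDerivAt X (κ (w (z, X z))) z) {z₀ : ℝ}
    (h0 : fderiv ℝ p (z₀, X z₀) (0, 1) + κ (w (z₀, X z₀)) * fderiv ℝ w (z₀, X z₀) (0, 1) ≠ 0)
    {ε T S : ℝ} (hε : 0 < ε) (hfwd : ∀ z, T ≤ z → ε ≤ κ' (w (z, X z))) (hbwd : ∀ z, z ≤ S → ε ≤ κ' (w (z, X z))) :
    False := by
  have hκhi0 : 0 < κhi := (hκpos _).trans_le (hκhi (0, X 0))
  have hq := johnGradient_hasDerivAt hw hp hK2 hKd hκd hsys1 hsys2 hκpos hX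
  have hα := forwardGradient_ne_zero hw hp hK2 hKd hκd hsys1 hsys2 hk₁ hW₁ hX h0
  -- the coefficient is `≥ ε / (2 κhi √κhi)` where `κ' ≥ ε`
  set b₀ : ℝ := ε / (2 * κhi) * Real.exp (-(Real.log κhi / 2)) with hb₀
  have hb₀pos : 0 < b₀ := by positivity
  have hGge : ∀ z, ε ≤ κ' (w (z, X z)) →
      b₀ ≤ κ' (w (z, X z)) / (2 * κ (w (z, X z))) * Real.exp (-(Real.log (κ (w (z, X z))) / 2)) := by
    intro z hz
    have hκp := hκpos (w (z, X z))
    have h1 : ε / (2 * κhi) ≤ κ' (w (z, X z)) / (2 * κ (w (z, X z))) := by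
      rw [div_le_div_iff₀ (by positivity) (by positivity)]
      have := hκhi (z, X z)
      nlinarith
    have h2 : Real.exp (-(Real.log κhi / 2)) ≤ Real.exp (-(Real.log (κ (w (z, X z))) / 2)) := by
      apply Real.exp_le_exp.2
      have := Real.log_le_log hκp (hκhi (z, X z))
      linarith
    calc b₀ = ε / (2 * κhi) * Real.exp (-(Real.log κhi / 2)) := hb₀
      _ ≤ κ' (w (z, X z)) / (2 * κ (w (z, X z))) * Real.exp (-(Real.log (κ (w (z, X z))) / 2)) :=
          mul_le_mul h1 h2 (Real.exp_pos _).le (le_trans (by positivity) h1)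
  exact riccati_no_twoSided_of_eventually_pos (b₀ := b₀) hq
    (fun z => mul_ne_zero (Real.exp_pos _).ne' (hα z)) hb₀pos (fun z hz => hGge z (hfwd z hz))
    (fun z hz => hGge z (hbwd z hz))

/-- **★ Structure of the residual, negative side**: nor can `κ'(w ∘ X)` be `≤ −ε < 0` on both half-lines. [folklore] -/
theorem loaded_char_not_eventually_neg (hw : ContDiff ℝ 2 w) (hp : ContDiff ℝ 2 p)
    (hK2 : ContDiff ℝ 2 K) (hKd : ∀ v, HasDerivAt K (κ v) v) (hκd : ∀ v, HasDerivAt κ (κ' v) v)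
    (hsys1 : ∀ q, fderiv ℝ p q (1, 0) = -(κ (w q) ^ 2 * fderiv ℝ w q (0, 1)))
    (hsys2 : ∀ q, fderiv ℝ w q (1, 0) = -fderiv ℝ p q (0, 1)) (hκpos : ∀ v, 0 < κ v)
    (hκhi : ∀ q, κ (w q) ≤ κhi) (hk₁ : ∀ q, |κ' (w q)| ≤ k₁) (hW₁ : ∀ q, |fderiv ℝ w q (0, 1)| ≤ W₁)
    (hX : ∀ z, HasDerivAt X (κ (w (z, X z))) z) {z₀ : ℝ}
    (h0 : fderiv ℝ p (z₀, X z₀) (0, 1) + κ (w (z₀, X z₀)) * fderiv ℝ w (z₀, X z₀) (0, 1) ≠ 0)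
    {ε T S : ℝ} (hε : 0 < ε) (hfwd : ∀ z, T ≤ z → κ' (w (z, X z)) ≤ -ε) (hbwd : ∀ z, z ≤ S → κ' (w (z, X z)) ≤ -ε) :
    False := by
  have hκhi0 : 0 < κhi := (hκpos _).trans_le (hκhi (0, X 0))
  have hq := johnGradient_hasDerivAt hw hp hK2 hKd hκd hsys1 hsys2 hκpos hX
  have hα := forwardGradient_ne_zero hw hp hK2 hKd hκd hsys1 hsys2 hk₁ hW₁ hX h0
  set b₀ : ℝ := ε / (2 * κhi) * Real.exp (-(Real.log κhi / 2)) with hb₀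
  have hb₀pos : 0 < b₀ := by positivity
  have hGle : ∀ z, κ' (w (z, X z)) ≤ -ε →
      κ' (w (z, X z)) / (2 * κ (w (z, X z))) * Real.exp (-(Real.log (κ (w (z, X z))) / 2)) ≤ -b₀ := by
    intro z hz
    have hκp := hκpos (w (z, X z))
    have h1 : ε / (2 * κhi) ≤ -κ' (w (z, X z)) / (2 * κ (w (z, X z))) := by
      rw [div_le_div_iff₀ (by positivity) (by positivity)]
      have := hκhi (z, X z)
      nlinarith
    have h2 : Real.exp (-(Real.log κhi / 2)) ≤ Real.exp (-(Real.log (κ (w (z, X z))) / 2)) := by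
      apply Real.exp_le_exp.2
      have := Real.log_le_log hκp (hκhi (z, X z))
      linarith
    have h3 : b₀ ≤ -κ' (w (z, X z)) / (2 * κ (w (z, X z))) * Real.exp (-(Real.log (κ (w (z, X z))) / 2)) :=
      calc b₀ = ε / (2 * κhi) * Real.exp (-(Real.log κhi / 2)) := hb₀
        _ ≤ -κ' (w (z, X z)) / (2 * κ (w (z, X z))) * Real.exp (-(Real.log (κ (w (z, X z))) / 2)) :=
            mul_le_mul h1 h2 (Real.exp_pos _).le (le_trans (by positivity) h1)
    have h4 : -κ' (w (z, X z)) / (2 * κ (w (z, X z))) * Real.exp (-(Real.log (κ (w (z, X z))) / 2)) =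
        -(κ' (w (z, X z)) / (2 * κ (w (z, X z))) * Real.exp (-(Real.log (κ (w (z, X z))) / 2))) := by ring
    linarith [h4 ▸ h3]
  exact riccati_no_twoSided_of_eventually_neg (b₀ := b₀) hq
    (fun z => mul_ne_zero (Real.exp_pos _).ne' (hα z)) hb₀pos (fun z hz => hGle z (hfwd z hz))
    (fun z hz => hGle z (hbwd z hz))

end Summit.NavierStokesRegularity.NavierStokesRegularity.Theorems.PoloidalWindowDoorPoloidalWindowRigidityZShockLoadedCharacteristics

end
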